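import Literature.Analysis.FluidPDE.AncientSimilarityVariables

/-!
# Crux `SymmetricScarExists` (stmt-NavierStokesRegularity-11718), line `logtime-bernoulli-certificate`:
# the Leray dictionary behind STUB 1 (`stub_apexLerayProfile`) — registered sub-goal `stub_apexLerayProfile_dictionary`

Helper file (`--supports stmt-NavierStokesRegularity-11718`; theorems only).  STUB 1 of the line's
skeleton asks for a smooth eternal solution `(U, P)` of the backward Leray system
`∂ₛU + ½U + ½(y·∇)U + (U·∇)U + ∇P = ΔU`, `div U = 0` (`IsBackwardLeraySolutionOn univ 1 U P`,
`AncientSimilarityVariables.lean`) with the eight weighted bounds `(1+‖y‖)‖U‖ ≤ C`,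
`(1+‖y‖)²‖∇U‖, (1+‖y‖)³‖D²U‖, (1+‖y‖)²|P|, (1+‖y‖)³‖∇P‖, (1+‖y‖)‖∂ₛU‖, (1+‖y‖)²‖∇∂ₛU‖,
(1+‖y‖)³‖∂ₛU + ½U + ½(y·∇)U‖ ≤ K`.  This file proves the DICTIONARY half (`stub_apexLerayProfile_dictionary`):
if `(v, q)` is a classical Navier–Stokes solution on the past `(−∞, 0) × ℝ³` with the Type-I bound
`‖v(t,x)‖ ≤ C/(‖x‖+√(−t))` and the PHYSICAL scale-invariant bounds `(‖x‖+√(−t))²‖∇v‖ ≤ K`,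
`(‖x‖+√(−t))³‖D²v‖ ≤ K`, `(‖x‖+√(−t))²|q| ≤ K`, `(‖x‖+√(−t))³‖∇q‖ ≤ K`, `(‖x‖+√(−t))³‖∂ₜv‖ ≤ K`,
`(‖x‖+√(−t))⁴‖∇∂ₜv‖ ≤ K`, then `U = lerayOrbit v` (`U(s,y) = e^{−s/2} v(−e^{−s}, e^{−s/2}y)`),
`P = lerayOrbitPressure q` solve the backward Leray system on `univ`
(`isClassicalNSSolutionOn_Iio_iff_isBackwardLeraySolutionOn`) with the eight bounds, velocity constant
the same `C` (`hasTypeIDecay_iff_lerayOrbit`) and `K' = K + K/2 + K + C` for the other seven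
(`profile_*_le`).  Inputs: the chain rules `fderiv_lerayOrbit`, `gradient_lerayOrbitPressure`,
`lerayOrbitForce_timeDeriv` (`∂ₛU + ½U + ½(y·∇)U = e^{−3s/2}∂ₜv`) of `AncientSimilarityVariables.lean`,
the weight identity `‖x‖ + √(−t) = e^{−s/2}(1 + ‖y‖)` at `(t,x) = (−e^{−s}, e^{−s/2}y)`
(`physWeight_eq`), and `D(z ↦ DU(z)[z]) = DU + D²U[·, z]` (Mathlib `HasFDerivAt.clm_apply`).
The companion file `RellichScarSymmetricScarExistsApexLerayProfile.lean` assembles STUB 1 from this,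
conditionally on the scale-invariant parabolic regularity of apex profiles.

## References

* D. Chae, J. Wolf, Comm. PDE 42 (2017) = arXiv:1610.09464, §4 (the change of variables).
  [ChaeWolf2017RemovingDSS]
* G. Koch, N. Nadirashvili, G. Seregin, V. Šverák, Acta Math. 203 (2009), (1.6). [KNSS2009]
-/

noncomputable section

open MeasureTheory Set Function Filter Topology
open scoped ContDiff

namespace Summit.NavierStokesRegularity.NavierStokesRegularity.Theorems.SymmetricScarExists.LogtimeBernoulli

open Literature.Analysis.FluidPDE

/-! ### Dilations and the similarity weights -/

/-- **Dilations and higher derivatives**: `‖Dᵏ(ψ(b ·))(x)‖ ≤ |b|ᵏ ‖Dᵏψ(b x)‖` for `b ≠ 0` (the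
dilation is a linear automorphism; no differentiability needed). [folklore] -/
theorem norm_iteratedFDeriv_comp_smul_le' {F : Type*} [NormedAddCommGroup F] [NormedSpace ℝ F]
    (ψ : (EuclideanSpace ℝ (Fin 3)) → F) {b : ℝ} (hb : b ≠ 0) (k : ℕ) (x : (EuclideanSpace ℝ (Fin 3))) :
    ‖iteratedFDeriv ℝ k (fun y => ψ (b • y)) x‖ ≤ |b| ^ k * ‖iteratedFDeriv ℝ k ψ (b • x)‖ := by
  -- adapted from `Literature.Analysis.FluidPDE.norm_iteratedFDeriv_comp_smul_le`
  -- (`KNSSLocalSmoothingHolds.lean`), copied to keep the import closure small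
  set e : (EuclideanSpace ℝ (Fin 3)) ≃L[ℝ] (EuclideanSpace ℝ (Fin 3)) :=
    ContinuousLinearEquiv.equivOfInverse (b • ContinuousLinearMap.id ℝ (EuclideanSpace ℝ (Fin 3)))
      (b⁻¹ • ContinuousLinearMap.id ℝ (EuclideanSpace ℝ (Fin 3))) (fun y => by simp [smul_smul, hb])
      (fun y => by simp [smul_smul, hb]) with he
  have hee : ∀ y, e y = b • y := fun y => rfl
  have hcomp : (fun y => ψ (b • y)) = ψ ∘ e := rfl
  have h := e.iteratedFDerivWithin_comp_right ψ uniqueDiffOn_univ (mem_univ (e x)) k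
  simp only [preimage_univ, iteratedFDerivWithin_univ] at h
  rw [hcomp, h, hee x, mul_comm]
  refine (ContinuousMultilinearMap.norm_compContinuousLinearMap_le _ _).trans ?_
  rw [Finset.prod_const, Finset.card_univ, Fintype.card_fin]
  refine mul_le_mul_of_nonneg_left (pow_le_pow_left₀ (norm_nonneg _) ?_ k) (norm_nonneg _)
  refine ContinuousLinearMap.opNorm_le_bound _ (abs_nonneg b) fun y => ?_
  rw [ContinuousLinearEquiv.coe_coe, hee y, norm_smul, Real.norm_eq_abs]

/-! ### The similarity weights -/

/-- At `(t, x) = Φ(s, y) = (−e^{−s}, e^{−s/2} y)` the physical weight `‖x‖ + √(−t)` is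
`e^{−s/2} (1 + ‖y‖)`. [folklore] -/
theorem physWeight_eq (s : ℝ) (y : (EuclideanSpace ℝ (Fin 3))) :
    ‖Real.exp (-s / 2) • y‖ + Real.sqrt (-(-Real.exp (-s))) = Real.exp (-s / 2) * (1 + ‖y‖) := by
  rw [neg_neg, sqrt_exp_neg, norm_smul, Real.norm_of_nonneg (Real.exp_pos _).le]
  ring

/-- Powers of the weight: `(‖x‖ + √(−t))ⁿ = (e^{−s/2})ⁿ (1 + ‖y‖)ⁿ` at `(t, x) = Φ(s, y)`. [folklore] -/
theorem physWeight_pow_eq (s : ℝ) (y : (EuclideanSpace ℝ (Fin 3))) (n : ℕ) :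
    (‖Real.exp (-s / 2) • y‖ + Real.sqrt (-(-Real.exp (-s)))) ^ n =
      Real.exp (-s / 2) ^ n * (1 + ‖y‖) ^ n := by
  rw [physWeight_eq, mul_pow]


/-! ### The dictionary: physical scale-invariant bounds ⇒ weighted profile bounds -/

section Dictionary

variable {v : ℝ → (EuclideanSpace ℝ (Fin 3)) → (EuclideanSpace ℝ (Fin 3))} {q : ℝ → (EuclideanSpace ℝ (Fin 3)) → ℝ} {C K : ℝ}

/-- On `S = univ` the one-sided time derivative is the two-sided one. [folklore] -/
theorem timeDerivWithin_univ_eq (U : ℝ → (EuclideanSpace ℝ (Fin 3)) → (EuclideanSpace ℝ (Fin 3))) (s : ℝ) (y : (EuclideanSpace ℝ (Fin 3))) :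
    timeDerivWithin univ U s y = timeDeriv U s y := by
  rw [timeDerivWithin_apply, derivWithin_univ, timeDeriv_apply]

/-- **Gradient**: `(‖x‖+√(−t))² ‖∇v‖ ≤ K` gives `(1+‖y‖)² ‖∇U‖ ≤ K` for `U = lerayOrbit v`
(`∇U(s,y) = e^{−s} ∇v(t,x)`). [folklore] -/
theorem profile_fderiv_le (h : ∀ t < 0, ∀ x, (‖x‖ + Real.sqrt (-t)) ^ 2 * ‖fderiv ℝ (v t) x‖ ≤ K)
    (s : ℝ) (y : (EuclideanSpace ℝ (Fin 3))) : (1 + ‖y‖) ^ 2 * ‖fderiv ℝ (lerayOrbit v s) y‖ ≤ K := by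
  have key := h _ (neg_exp_neg_lt_zero s) (Real.exp (-s / 2) • y)
  rw [physWeight_pow_eq, exp_neg_half_sq] at key
  rw [fderiv_lerayOrbit, norm_smul, Real.norm_of_nonneg (Real.exp_pos _).le]
  calc (1 + ‖y‖) ^ 2 * (Real.exp (-s) *
        ‖fderiv ℝ (v (-Real.exp (-s))) (Real.exp (-s / 2) • y)‖)
      = Real.exp (-s) * (1 + ‖y‖) ^ 2 *
        ‖fderiv ℝ (v (-Real.exp (-s))) (Real.exp (-s / 2) • y)‖ := by ring
    _ ≤ K := key

/-- **Hessian**: `(‖x‖+√(−t))³ ‖D²v‖ ≤ K` gives `(1+‖y‖)³ ‖D²U‖ ≤ K` (`D²U(s,y) = e^{−3s/2} D²v(t,x)`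
up to the dilation of the arguments, which does not increase the norm). [folklore] -/
theorem profile_iteratedFDeriv_two_le (hv : ∀ t < 0, ContDiff ℝ 2 (v t))
    (h : ∀ t < 0, ∀ x, (‖x‖ + Real.sqrt (-t)) ^ 3 * ‖iteratedFDeriv ℝ 2 (v t) x‖ ≤ K)
    (s : ℝ) (y : (EuclideanSpace ℝ (Fin 3))) : (1 + ‖y‖) ^ 3 * ‖iteratedFDeriv ℝ 2 (lerayOrbit v s) y‖ ≤ K := by
  have ht : -Real.exp (-s) < 0 := neg_exp_neg_lt_zero s
  have ha0 : 0 < Real.exp (-s / 2) := Real.exp_pos _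
  have key := h _ ht (Real.exp (-s / 2) • y)
  rw [physWeight_pow_eq] at key
  have e : lerayOrbit v s = Real.exp (-s / 2) • fun z => v (-Real.exp (-s)) (Real.exp (-s / 2) • z) := by
    funext z; rfl
  have hct : ContDiffAt ℝ 2 (fun z => v (-Real.exp (-s)) (Real.exp (-s / 2) • z)) y :=
    ((hv _ ht).comp (contDiff_const_smul _)).contDiffAt
  rw [e, iteratedFDeriv_const_smul_apply hct, norm_smul, Real.norm_of_nonneg ha0.le]
  have h2 := norm_iteratedFDeriv_comp_smul_le' (v (-Real.exp (-s))) ha0.ne' 2 y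
  rw [abs_of_pos ha0] at h2
  calc (1 + ‖y‖) ^ 3 * (Real.exp (-s / 2) *
        ‖iteratedFDeriv ℝ 2 (fun z => v (-Real.exp (-s)) (Real.exp (-s / 2) • z)) y‖)
      ≤ (1 + ‖y‖) ^ 3 * (Real.exp (-s / 2) * (Real.exp (-s / 2) ^ 2 *
        ‖iteratedFDeriv ℝ 2 (v (-Real.exp (-s))) (Real.exp (-s / 2) • y)‖)) := by gcongr
    _ = Real.exp (-s / 2) ^ 3 * (1 + ‖y‖) ^ 3 *
        ‖iteratedFDeriv ℝ 2 (v (-Real.exp (-s))) (Real.exp (-s / 2) • y)‖ := by ring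
    _ ≤ K := key

/-- **Pressure**: `(‖x‖+√(−t))² |q| ≤ K` gives `(1+‖y‖)² |P| ≤ K` for `P = lerayOrbitPressure q`
(`P(s,y) = e^{−s} q(t,x)`). [folklore] -/
theorem profile_pressure_le (h : ∀ t < 0, ∀ x, (‖x‖ + Real.sqrt (-t)) ^ 2 * |q t x| ≤ K)
    (s : ℝ) (y : (EuclideanSpace ℝ (Fin 3))) : (1 + ‖y‖) ^ 2 * |lerayOrbitPressure q s y| ≤ K := by
  have key := h _ (neg_exp_neg_lt_zero s) (Real.exp (-s / 2) • y)
  rw [physWeight_pow_eq, exp_neg_half_sq] at key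
  rw [lerayOrbitPressure_apply, abs_mul, abs_of_pos (Real.exp_pos _)]
  calc (1 + ‖y‖) ^ 2 * (Real.exp (-s) * |q (-Real.exp (-s)) (Real.exp (-s / 2) • y)|)
      = Real.exp (-s) * (1 + ‖y‖) ^ 2 * |q (-Real.exp (-s)) (Real.exp (-s / 2) • y)| := by
        ring
    _ ≤ K := key

/-- **Pressure gradient**: `(‖x‖+√(−t))³ ‖∇q‖ ≤ K` gives `(1+‖y‖)³ ‖∇P‖ ≤ K`
(`∇P(s,y) = e^{−3s/2} ∇q(t,x)`). [folklore] -/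
theorem profile_gradient_pressure_le
    (h : ∀ t < 0, ∀ x, (‖x‖ + Real.sqrt (-t)) ^ 3 * ‖gradient (q t) x‖ ≤ K)
    (s : ℝ) (y : (EuclideanSpace ℝ (Fin 3))) : (1 + ‖y‖) ^ 3 * ‖gradient (lerayOrbitPressure q s) y‖ ≤ K := by
  have key := h _ (neg_exp_neg_lt_zero s) (Real.exp (-s / 2) • y)
  rw [physWeight_pow_eq] at key
  rw [gradient_lerayOrbitPressure, lerayOrbitForce_apply, norm_smul,
    Real.norm_of_nonneg (pow_nonneg (Real.exp_pos _).le 3)]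
  calc (1 + ‖y‖) ^ 3 * (Real.exp (-s / 2) ^ 3 *
        ‖gradient (q (-Real.exp (-s))) (Real.exp (-s / 2) • y)‖)
      = Real.exp (-s / 2) ^ 3 * (1 + ‖y‖) ^ 3 *
        ‖gradient (q (-Real.exp (-s))) (Real.exp (-s / 2) • y)‖ := by ring
    _ ≤ K := key

/-- **The Leray part of the profile equation**: for a classical solution on the past,
`∂ₛU + ½U + ½(y·∇)U = e^{−3s/2} ∂ₜv(t,x)` (two-sided `∂ₛ`, `timeDerivWithin univ`), so
`(‖x‖+√(−t))³ ‖∂ₜv‖ ≤ K` gives `(1+‖y‖)³ ‖∂ₛU + ½U + ½(y·∇)U‖ ≤ K`.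
[cite: ChaeWolf2017RemovingDSS, §4 (proof of Thm. 1.5)] -/
theorem profile_leray_le (hcl : IsClassicalNSSolutionOn (Iio 0) 1 0 v q)
    (h : ∀ t < 0, ∀ x, (‖x‖ + Real.sqrt (-t)) ^ 3 * ‖timeDeriv v t x‖ ≤ K) (s : ℝ) (y : (EuclideanSpace ℝ (Fin 3))) :
    (1 + ‖y‖) ^ 3 * ‖timeDerivWithin (univ : Set ℝ) (lerayOrbit v) s y +
      (1 / 2 : ℝ) • lerayOrbit v s y + (1 / 2 : ℝ) • fderiv ℝ (lerayOrbit v s) y y‖ ≤ K := by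
  have ht : -Real.exp (-s) < 0 := neg_exp_neg_lt_zero s
  have key := h _ ht (Real.exp (-s / 2) • y)
  rw [physWeight_pow_eq] at key
  have hd : DifferentiableAt ℝ (uncurry v) (ancientSimMap (s, y)) :=
    (hcl.smooth_velocity.contDiffAt isOpen_Iio ht _).differentiableAt (by simp)
  rw [timeDerivWithin_univ_eq, lerayOrbitForce_timeDeriv hd, lerayOrbitForce_apply, norm_smul,
    Real.norm_of_nonneg (pow_nonneg (Real.exp_pos _).le 3)]
  calc (1 + ‖y‖) ^ 3 * (Real.exp (-s / 2) ^ 3 *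
        ‖timeDeriv v (-Real.exp (-s)) (Real.exp (-s / 2) • y)‖)
      = Real.exp (-s / 2) ^ 3 * (1 + ‖y‖) ^ 3 *
        ‖timeDeriv v (-Real.exp (-s)) (Real.exp (-s / 2) • y)‖ := by ring
    _ ≤ K := key

/-- `∂ₛU = e^{−3s/2} ∂ₜv(t,x) − ½U − ½(y·∇)U` for a classical solution on the past (rearranged
`lerayOrbitForce_timeDeriv`). [cite: ChaeWolf2017RemovingDSS, §4 (proof of Thm. 1.5)] -/
theorem timeDeriv_lerayOrbit_eq (hcl : IsClassicalNSSolutionOn (Iio 0) 1 0 v q) (s : ℝ) (y : (EuclideanSpace ℝ (Fin 3))) :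
    timeDeriv (lerayOrbit v) s y = lerayOrbitForce (timeDeriv v) s y
      - (1 / 2 : ℝ) • lerayOrbit v s y - (1 / 2 : ℝ) • fderiv ℝ (lerayOrbit v s) y y := by
  have hd : DifferentiableAt ℝ (uncurry v) (ancientSimMap (s, y)) :=
    (hcl.smooth_velocity.contDiffAt isOpen_Iio (neg_exp_neg_lt_zero s) _).differentiableAt
      (by simp)
  rw [← lerayOrbitForce_timeDeriv hd]
  abel

/-- **Time derivative**: `(1+‖y‖) ‖∂ₛU‖ ≤ K + C/2 + K/2` from the Leray part (`≤ K/(1+‖y‖)³`),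
the velocity bound (`(1+‖y‖)‖U‖ ≤ C`) and the gradient bound (`(1+‖y‖)²‖∇U‖ ≤ K`). [folklore] -/
theorem profile_timeDeriv_le (hcl : IsClassicalNSSolutionOn (Iio 0) 1 0 v q)
    (hU : ∀ s y, (1 + ‖y‖) * ‖lerayOrbit v s y‖ ≤ C)
    (hD : ∀ s y, (1 + ‖y‖) ^ 2 * ‖fderiv ℝ (lerayOrbit v s) y‖ ≤ K)
    (h : ∀ t < 0, ∀ x, (‖x‖ + Real.sqrt (-t)) ^ 3 * ‖timeDeriv v t x‖ ≤ K) (s : ℝ) (y : (EuclideanSpace ℝ (Fin 3))) :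
    (1 + ‖y‖) * ‖timeDerivWithin (univ : Set ℝ) (lerayOrbit v) s y‖ ≤ K + C / 2 + K / 2 := by
  have hy1 : 1 ≤ 1 + ‖y‖ := le_add_of_nonneg_right (norm_nonneg _)
  have hy0 : 0 ≤ 1 + ‖y‖ := by positivity
  -- the three pieces
  have hF : (1 + ‖y‖) * ‖lerayOrbitForce (timeDeriv v) s y‖ ≤ K := by
    have h3 := profile_leray_le hcl h s y
    have hd : DifferentiableAt ℝ (uncurry v) (ancientSimMap (s, y)) :=
      (hcl.smooth_velocity.contDiffAt isOpen_Iio (neg_exp_neg_lt_zero s) _).differentiableAt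
        (by simp)
    rw [timeDerivWithin_univ_eq, lerayOrbitForce_timeDeriv hd] at h3
    calc (1 + ‖y‖) * ‖lerayOrbitForce (timeDeriv v) s y‖
        ≤ (1 + ‖y‖) ^ 3 * ‖lerayOrbitForce (timeDeriv v) s y‖ := by
          refine mul_le_mul_of_nonneg_right ?_ (norm_nonneg _)
          calc (1 + ‖y‖) = (1 + ‖y‖) ^ 1 := (pow_one _).symm
            _ ≤ (1 + ‖y‖) ^ 3 := pow_le_pow_right₀ hy1 (by norm_num)
      _ ≤ K := h3
  have hA : (1 + ‖y‖) * ‖(1 / 2 : ℝ) • lerayOrbit v s y‖ ≤ C / 2 := by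
    rw [norm_smul, Real.norm_of_nonneg (by norm_num : (0 : ℝ) ≤ 1 / 2)]
    have := hU s y
    nlinarith [norm_nonneg (lerayOrbit v s y)]
  have hB : (1 + ‖y‖) * ‖(1 / 2 : ℝ) • fderiv ℝ (lerayOrbit v s) y y‖ ≤ K / 2 := by
    rw [norm_smul, Real.norm_of_nonneg (by norm_num : (0 : ℝ) ≤ 1 / 2)]
    have h1 : ‖fderiv ℝ (lerayOrbit v s) y y‖ ≤ ‖fderiv ℝ (lerayOrbit v s) y‖ * (1 + ‖y‖) :=
      (ContinuousLinearMap.le_opNorm _ _).trans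
        (mul_le_mul_of_nonneg_left (by linarith [norm_nonneg y]) (norm_nonneg _))
    have h2 := hD s y
    calc (1 + ‖y‖) * (1 / 2 * ‖fderiv ℝ (lerayOrbit v s) y y‖)
        ≤ (1 + ‖y‖) * (1 / 2 * (‖fderiv ℝ (lerayOrbit v s) y‖ * (1 + ‖y‖))) := by gcongr
      _ = 1 / 2 * ((1 + ‖y‖) ^ 2 * ‖fderiv ℝ (lerayOrbit v s) y‖) := by ring
      _ ≤ 1 / 2 * K := by gcongr
      _ = K / 2 := by ring
  rw [timeDerivWithin_univ_eq, timeDeriv_lerayOrbit_eq hcl]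
  calc (1 + ‖y‖) * ‖lerayOrbitForce (timeDeriv v) s y - (1 / 2 : ℝ) • lerayOrbit v s y -
        (1 / 2 : ℝ) • fderiv ℝ (lerayOrbit v s) y y‖
      ≤ (1 + ‖y‖) * (‖lerayOrbitForce (timeDeriv v) s y‖ + ‖(1 / 2 : ℝ) • lerayOrbit v s y‖ +
        ‖(1 / 2 : ℝ) • fderiv ℝ (lerayOrbit v s) y y‖) := by
          refine mul_le_mul_of_nonneg_left ?_ hy0
          exact (norm_sub_le _ _).trans (add_le_add (norm_sub_le _ _) le_rfl)
    _ ≤ K + C / 2 + K / 2 := by linarith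

/-- `‖D(DU)(y)‖ = ‖D²U(y)‖` (the curried second derivative has the norm of the iterated one).
[folklore] -/
theorem norm_fderiv_fderiv_eq (U : (EuclideanSpace ℝ (Fin 3)) → (EuclideanSpace ℝ (Fin 3))) (y : (EuclideanSpace ℝ (Fin 3))) :
    ‖fderiv ℝ (fderiv ℝ U) y‖ = ‖iteratedFDeriv ℝ 2 U y‖ := by
  calc ‖fderiv ℝ (fderiv ℝ U) y‖ = ‖iteratedFDeriv ℝ 0 (fderiv ℝ (fderiv ℝ U)) y‖ := by
        rw [norm_iteratedFDeriv_zero]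
    _ = ‖iteratedFDeriv ℝ (0 + 1 + 1) U y‖ := by
        rw [norm_iteratedFDeriv_fderiv, norm_iteratedFDeriv_fderiv]
    _ = ‖iteratedFDeriv ℝ 2 U y‖ := by norm_num

/-- **Gradient of the time derivative**: `(1+‖y‖)² ‖∇∂ₛU‖ ≤ K + K/2 + K`, from
`∂ₛU(s,z) = e^{−3s/2} ∂ₜv(t, e^{−s/2}z) − ½U(s,z) − ½ DU(s,z)[z]`: the three terms have derivatives
`e^{−2s}(∇∂ₜv)(t,x)`, `½∇U` and `½(DU + D²U[·, z])`, bounded by the scale-invariant bound on `∇∂ₜv`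
and the profile bounds on `∇U`, `D²U`. [folklore] -/
theorem profile_fderiv_timeDeriv_le (hcl : IsClassicalNSSolutionOn (Iio 0) 1 0 v q)
    (hD : ∀ s y, (1 + ‖y‖) ^ 2 * ‖fderiv ℝ (lerayOrbit v s) y‖ ≤ K)
    (hD2 : ∀ s y, (1 + ‖y‖) ^ 3 * ‖iteratedFDeriv ℝ 2 (lerayOrbit v s) y‖ ≤ K)
    (h : ∀ t < 0, ∀ x, (‖x‖ + Real.sqrt (-t)) ^ 4 * ‖fderiv ℝ (timeDeriv v t) x‖ ≤ K)
    (s : ℝ) (y : (EuclideanSpace ℝ (Fin 3))) :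
    (1 + ‖y‖) ^ 2 * ‖fderiv ℝ (fun z => timeDerivWithin (univ : Set ℝ) (lerayOrbit v) s z) y‖ ≤
      K + K / 2 + K := by
  have ht : -Real.exp (-s) < 0 := neg_exp_neg_lt_zero s
  have ha0 : 0 < Real.exp (-s / 2) := Real.exp_pos _
  have hy1 : 1 ≤ 1 + ‖y‖ := le_add_of_nonneg_right (norm_nonneg _)
  have hy0 : 0 ≤ 1 + ‖y‖ := by positivity
  -- `∂ₛU` as a function of `z`
  have hfun : (fun z => timeDerivWithin (univ : Set ℝ) (lerayOrbit v) s z) = fun z =>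
      Real.exp (-s / 2) ^ 3 • timeDeriv v (-Real.exp (-s)) (Real.exp (-s / 2) • z)
        - (1 / 2 : ℝ) • lerayOrbit v s z - (1 / 2 : ℝ) • fderiv ℝ (lerayOrbit v s) z z := by
    funext z
    rw [timeDerivWithin_univ_eq, timeDeriv_lerayOrbit_eq hcl, lerayOrbitForce_apply]
  -- (i) the transported time derivative
  have hws : ContDiff ℝ ∞ (timeDeriv v (-Real.exp (-s))) :=
    (hcl.smooth_velocity.isSmoothSpaceTimeOn_deriv isOpen_Iio).contDiff_slice ht
  have hwd : Differentiable ℝ (timeDeriv v (-Real.exp (-s))) := hws.differentiable (by simp)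
  have hF : HasFDerivAt
      (fun z => Real.exp (-s / 2) ^ 3 • timeDeriv v (-Real.exp (-s)) (Real.exp (-s / 2) • z))
      ((Real.exp (-s / 2) ^ 3 * Real.exp (-s / 2)) •
        fderiv ℝ (timeDeriv v (-Real.exp (-s))) (Real.exp (-s / 2) • y)) y := by
    have hd : DifferentiableAt ℝ
        (fun z => Real.exp (-s / 2) ^ 3 • timeDeriv v (-Real.exp (-s)) (Real.exp (-s / 2) • z)) y :=
      ((hwd.comp (differentiable_id.const_smul (Real.exp (-s / 2)))).const_smul
        (Real.exp (-s / 2) ^ 3)) y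
    have h1 := hd.hasFDerivAt
    rwa [fderiv_const_smul_comp_smul'] at h1
  -- (ii) the profile slice
  have hUs : ContDiff ℝ ∞ (lerayOrbit v s) :=
    ((hcl.contDiff_velocity ht).comp (contDiff_const_smul (Real.exp (-s / 2)))).const_smul
      (Real.exp (-s / 2))
  have hU : HasFDerivAt (lerayOrbit v s) (fderiv ℝ (lerayOrbit v s) y) y :=
    ((hUs.differentiable (by simp)) y).hasFDerivAt
  -- (iii) the drift term `z ↦ DU(z)[z]`
  have hc : ContDiff ℝ ∞ (fderiv ℝ (lerayOrbit v s)) := (contDiff_infty_iff_fderiv.1 hUs).2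
  have hc' : HasFDerivAt (fderiv ℝ (lerayOrbit v s)) (fderiv ℝ (fderiv ℝ (lerayOrbit v s)) y) y :=
    ((hc.differentiable (by simp)) y).hasFDerivAt
  have hG : HasFDerivAt (fun z => fderiv ℝ (lerayOrbit v s) z z)
      ((fderiv ℝ (lerayOrbit v s) y).comp (ContinuousLinearMap.id ℝ (EuclideanSpace ℝ (Fin 3))) +
        (fderiv ℝ (fderiv ℝ (lerayOrbit v s)) y).flip (id y)) y :=
    hc'.clm_apply (hasFDerivAt_id y)
  -- assemble the derivative
  have hsum : HasFDerivAt (fun z =>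
      Real.exp (-s / 2) ^ 3 • timeDeriv v (-Real.exp (-s)) (Real.exp (-s / 2) • z)
        - (1 / 2 : ℝ) • lerayOrbit v s z - (1 / 2 : ℝ) • fderiv ℝ (lerayOrbit v s) z z) _ y :=
    (hF.sub (hU.const_smul (1 / 2 : ℝ))).sub (hG.const_smul (1 / 2 : ℝ))
  rw [hfun, hsum.fderiv]
  -- the three bounds
  have T1 : (1 + ‖y‖) ^ 2 * ‖(Real.exp (-s / 2) ^ 3 * Real.exp (-s / 2)) •
      fderiv ℝ (timeDeriv v (-Real.exp (-s))) (Real.exp (-s / 2) • y)‖ ≤ K := by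
    have key := h _ ht (Real.exp (-s / 2) • y)
    rw [physWeight_pow_eq] at key
    rw [norm_smul, Real.norm_of_nonneg (by positivity)]
    have hX : 0 ≤ Real.exp (-s / 2) ^ 4 *
        ‖fderiv ℝ (timeDeriv v (-Real.exp (-s))) (Real.exp (-s / 2) • y)‖ := by positivity
    calc (1 + ‖y‖) ^ 2 * (Real.exp (-s / 2) ^ 3 * Real.exp (-s / 2) *
          ‖fderiv ℝ (timeDeriv v (-Real.exp (-s))) (Real.exp (-s / 2) • y)‖)
        = (1 + ‖y‖) ^ 2 * (Real.exp (-s / 2) ^ 4 *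
          ‖fderiv ℝ (timeDeriv v (-Real.exp (-s))) (Real.exp (-s / 2) • y)‖) := by ring
      _ ≤ (1 + ‖y‖) ^ 4 * (Real.exp (-s / 2) ^ 4 *
          ‖fderiv ℝ (timeDeriv v (-Real.exp (-s))) (Real.exp (-s / 2) • y)‖) :=
          mul_le_mul_of_nonneg_right (pow_le_pow_right₀ hy1 (by norm_num)) hX
      _ = Real.exp (-s / 2) ^ 4 * (1 + ‖y‖) ^ 4 *
          ‖fderiv ℝ (timeDeriv v (-Real.exp (-s))) (Real.exp (-s / 2) • y)‖ := by ring
      _ ≤ K := key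
  have T2 : (1 + ‖y‖) ^ 2 * ‖(1 / 2 : ℝ) • fderiv ℝ (lerayOrbit v s) y‖ ≤ K / 2 := by
    rw [norm_smul, Real.norm_of_nonneg (by norm_num : (0 : ℝ) ≤ 1 / 2)]
    have := hD s y
    nlinarith [norm_nonneg (fderiv ℝ (lerayOrbit v s) y)]
  have T3 : (1 + ‖y‖) ^ 2 * ‖(1 / 2 : ℝ) • ((fderiv ℝ (lerayOrbit v s) y).comp
      (ContinuousLinearMap.id ℝ (EuclideanSpace ℝ (Fin 3))) + (fderiv ℝ (fderiv ℝ (lerayOrbit v s)) y).flip (id y))‖ ≤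
      K := by
    rw [norm_smul, Real.norm_of_nonneg (by norm_num : (0 : ℝ) ≤ 1 / 2),
      ContinuousLinearMap.comp_id, id]
    have h1 : ‖(fderiv ℝ (fderiv ℝ (lerayOrbit v s)) y).flip y‖ ≤
        ‖iteratedFDeriv ℝ 2 (lerayOrbit v s) y‖ * (1 + ‖y‖) := by
      refine (ContinuousLinearMap.le_opNorm _ _).trans ?_
      rw [ContinuousLinearMap.opNorm_flip, norm_fderiv_fderiv_eq]
      exact mul_le_mul_of_nonneg_left (by linarith [norm_nonneg y]) (norm_nonneg _)
    have h2 := hD s y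
    have h3 := hD2 s y
    have h4 : ‖fderiv ℝ (lerayOrbit v s) y + (fderiv ℝ (fderiv ℝ (lerayOrbit v s)) y).flip y‖ ≤
        ‖fderiv ℝ (lerayOrbit v s) y‖ + ‖iteratedFDeriv ℝ 2 (lerayOrbit v s) y‖ * (1 + ‖y‖) :=
      (norm_add_le _ _).trans (add_le_add le_rfl h1)
    calc (1 + ‖y‖) ^ 2 * (1 / 2 *
          ‖fderiv ℝ (lerayOrbit v s) y + (fderiv ℝ (fderiv ℝ (lerayOrbit v s)) y).flip y‖)
        ≤ (1 + ‖y‖) ^ 2 * (1 / 2 * (‖fderiv ℝ (lerayOrbit v s) y‖ +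
          ‖iteratedFDeriv ℝ 2 (lerayOrbit v s) y‖ * (1 + ‖y‖))) := by gcongr
      _ = 1 / 2 * ((1 + ‖y‖) ^ 2 * ‖fderiv ℝ (lerayOrbit v s) y‖) +
          1 / 2 * ((1 + ‖y‖) ^ 3 * ‖iteratedFDeriv ℝ 2 (lerayOrbit v s) y‖) := by ring
      _ ≤ 1 / 2 * K + 1 / 2 * K := by gcongr
      _ = K := by ring
  calc (1 + ‖y‖) ^ 2 * ‖(Real.exp (-s / 2) ^ 3 * Real.exp (-s / 2)) •
        fderiv ℝ (timeDeriv v (-Real.exp (-s))) (Real.exp (-s / 2) • y) -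
        (1 / 2 : ℝ) • fderiv ℝ (lerayOrbit v s) y -
        (1 / 2 : ℝ) • ((fderiv ℝ (lerayOrbit v s) y).comp (ContinuousLinearMap.id ℝ (EuclideanSpace ℝ (Fin 3))) +
          (fderiv ℝ (fderiv ℝ (lerayOrbit v s)) y).flip (id y))‖
      ≤ (1 + ‖y‖) ^ 2 * (‖(Real.exp (-s / 2) ^ 3 * Real.exp (-s / 2)) •
        fderiv ℝ (timeDeriv v (-Real.exp (-s))) (Real.exp (-s / 2) • y)‖ +
        ‖(1 / 2 : ℝ) • fderiv ℝ (lerayOrbit v s) y‖ +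
        ‖(1 / 2 : ℝ) • ((fderiv ℝ (lerayOrbit v s) y).comp (ContinuousLinearMap.id ℝ (EuclideanSpace ℝ (Fin 3))) +
          (fderiv ℝ (fderiv ℝ (lerayOrbit v s)) y).flip (id y))‖) := by
        refine mul_le_mul_of_nonneg_left ?_ (by positivity)
        exact (norm_sub_le _ _).trans (add_le_add (norm_sub_le _ _) le_rfl)
    _ ≤ K + K / 2 + K := by linarith

end Dictionary

/-! ### The dictionary, assembled (registered sub-goal) -/

/-- **Registered sub-goal `stub_apexLerayProfile_dictionary` of STUB 1** (the Leray dictionary): a classical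
solution `(v, q)` of Navier–Stokes (`ν = 1`, `f = 0`) on `(−∞, 0) × ℝ³` with the Type-I bound
`‖v(t,x)‖ ≤ C/(‖x‖+√(−t))` and the six physical scale-invariant bounds with constant `K` yields, in
backward similarity variables `U = lerayOrbit v`, `P = lerayOrbitPressure q`, a smooth ETERNAL solution
of the backward Leray system with the eight weighted bounds (velocity `C`; the rest `K + K/2 + K + C`).
[cite: ChaeWolf2017RemovingDSS, §4 (proof of Thm. 1.5)] -/
theorem stub_apexLerayProfile_dictionary :
    ∀ (v : ℝ → EuclideanSpace ℝ (Fin 3) → EuclideanSpace ℝ (Fin 3)) (q : ℝ → EuclideanSpace ℝ (Fin 3) → ℝ) (C K : ℝ), Literature.Analysis.FluidPDE.IsClassicalNSSolutionOn (Set.Iio 0) 1 0 v q → Literature.Analysis.FluidPDE.HasTypeIDecay C v → (∀ t < (0 : ℝ), ∀ (x : EuclideanSpace ℝ (Fin 3)), (‖x‖ + Real.sqrt (-t)) ^ 2 * ‖fderiv ℝ (v t) x‖ ≤ K ∧ (‖x‖ + Real.sqrt (-t)) ^ 3 * ‖iteratedFDeriv ℝ 2 (v t) x‖ ≤ K ∧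 (‖x‖ + Real.sqrt (-t)) ^ 2 * |q t x| ≤ K ∧ (‖x‖ + Real.sqrt (-t)) ^ 3 * ‖gradient (q t) x‖ ≤ K ∧ (‖x‖ + Real.sqrt (-t)) ^ 3 * ‖Literature.Analysis.FluidPDE.timeDeriv v t x‖ ≤ K ∧ (‖x‖ + Real.sqrt (-t)) ^ 4 * ‖fderiv ℝ (Literature.Analysis.FluidPDE.timeDeriv v t) x‖ ≤ K) → Literature.Analysis.FluidPDE.IsBackwardLeraySolutionOn (Set.univ : Set ℝ) 1 (Literature.Analysis.FluidPDE.lerayOrbit v) (Literature.Analysis.FluidPDE.lerayOrbitPressure q) ∧ ∀ (s : ℝ) (y : EuclideanSpace ℝ (Fin 3)), (1 + ‖y‖) * ‖Literature.Analysis.FluidPDE.lerayOrbit v s y‖ ≤ C ∧ (1 + ‖y‖) ^ 2 * ‖fderiv ℝ (Literature.Analysis.FluidPDE.lerayOrbit v s) y‖ ≤ K + K / 2 + K + C ∧ (1 + ‖y‖) ^ 3 * ‖iteratedFDeriv ℝ 2 (Literature.Analysis.FluidPDE.lerayOrbit v s) y‖ ≤ K + K / 2 + K + C ∧ (1 + ‖y‖)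 ^ 2 * |Literature.Analysis.FluidPDE.lerayOrbitPressure q s y| ≤ K + K / 2 + K + C ∧ (1 + ‖y‖) ^ 3 * ‖gradient (Literature.Analysis.FluidPDE.lerayOrbitPressure q s) y‖ ≤ K + K / 2 + K + C ∧ (1 + ‖y‖) * ‖Literature.Analysis.FluidPDE.timeDerivWithin (Set.univ : Set ℝ) (Literature.Analysis.FluidPDE.lerayOrbit v) s y‖ ≤ K + K / 2 + K + C ∧ (1 + ‖y‖) ^ 2 * ‖fderiv ℝ (fun z => Literature.Analysis.FluidPDE.timeDerivWithin (Set.univ : Set ℝ) (Literature.Analysis.FluidPDE.lerayOrbit v) s z) y‖ ≤ K + K / 2 + K + C ∧ (1 + ‖y‖) ^ 3 * ‖Literature.Analysis.FluidPDE.timeDerivWithin (Set.univ : Set ℝ) (Literature.Analysis.FluidPDE.lerayOrbit v) s y + (1 / 2 : ℝ) • Literature.Analysis.FluidPDE.lerayOrbit v s y + (1 / 2 : ℝ) • fderiv ℝ (Literature.Analysis.FluidPDE.lerayOrbit v s) y y‖ ≤ K + K / 2 + K + C := by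
  intro v q C K hcl hdecv hb
  have hC : 0 ≤ C := by
    have h1 := hdecv (-1) (by norm_num) 0
    rw [norm_zero, zero_add, neg_neg, Real.sqrt_one, div_one] at h1
    exact (norm_nonneg _).trans h1
  have hK : 0 ≤ K := le_trans (by positivity) (hb (-1) (by norm_num) 0).1
  have hv2 : ∀ t < 0, ContDiff ℝ 2 (v t) := fun t ht => (hcl.contDiff_velocity ht).of_le (by norm_cast)
  have hU1 : ∀ s y, (1 + ‖y‖) * ‖lerayOrbit v s y‖ ≤ C := hasTypeIDecay_iff_lerayOrbit.1 hdecv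
  have hD : ∀ s y, (1 + ‖y‖) ^ 2 * ‖fderiv ℝ (lerayOrbit v s) y‖ ≤ K :=
    profile_fderiv_le fun t ht x => (hb t ht x).1
  have hD2 : ∀ s y, (1 + ‖y‖) ^ 3 * ‖iteratedFDeriv ℝ 2 (lerayOrbit v s) y‖ ≤ K :=
    profile_iteratedFDeriv_two_le hv2 fun t ht x => (hb t ht x).2.1
  have hT : ∀ t < 0, ∀ x, (‖x‖ + Real.sqrt (-t)) ^ 3 * ‖timeDeriv v t x‖ ≤ K :=
    fun t ht x => (hb t ht x).2.2.2.2.1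
  refine ⟨isClassicalNSSolutionOn_Iio_iff_isBackwardLeraySolutionOn.1 hcl, fun s y => ?_⟩
  refine ⟨hU1 s y, ?_, ?_, ?_, ?_, ?_, ?_, ?_⟩
  · linarith [hD s y]
  · linarith [hD2 s y]
  · linarith [profile_pressure_le (fun t ht x => (hb t ht x).2.2.1) s y]
  · linarith [profile_gradient_pressure_le (fun t ht x => (hb t ht x).2.2.2.1) s y]
  · linarith [profile_timeDeriv_le hcl hU1 hD hT s y]
  · linarith [profile_fderiv_timeDeriv_le hcl hD hD2 (fun t ht x => (hb t ht x).2.2.2.2.2) s y]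
  · linarith [profile_leray_le hcl hT s y]

end Summit.NavierStokesRegularity.NavierStokesRegularity.Theorems.SymmetricScarExists.LogtimeBernoulli

end
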